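import Mathlib
import Literature.MathematicalPhysics.QuantumFieldTheory.Balaban1983to89.B5Constraint130

/-!
# B5 (1.30): the adjoint block averaging `Q′*_k` and its momentum representation
# «\overline{u_k(p)} ω̃(p′)»

Source: T. Bałaban, *Propagators and renormalization transformations for lattice gauge
theories. I*, Commun. Math. Phys. 95 (1984) 17–40 (`Balaban1984PropagatorsI`, "B5"), renders
`b2b-balaban-ref1/pages/1984-cmp95-propagators-rt-I/…-pNNN-x2.png` (PDF page = journal page − 16),
read as images.

## What the paper prints (verbatim)

* p. 20 [PDF 4]: «or denoting (Q′_kλ)(y) = Σ_{x∈B^k(y)} η^dλ(x), we have Q_kA^λ = Q_kA − ∂Q′_kλ.»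
* p. 22/23 [PDF 6/7], the variational equations of Sect. C written «using the Fourier
  transformation» (1.29) «f̃(p) = Σ_{x∈T′_η} η^d e^{−ip·x} f(x), p ∈ T̃′_η», as (1.30):
  «Δ²(p)λ̃(p) − Δ(p)(∂*A)~(p) + \overline{u_k(p)} ω̃(p′) = 0, Σ_l u_k(p′+l) λ̃(p′+l) = 0»,
  where (1.31) «u_k(p) = Π_μ ∂¹_μ(p′)/∂_μ(p)» and «p ∈ T̃_η is represented as a sum p = p′ + l,
  p′ ∈ T̃₁^{(k)} and l = (l₁,…,l_d), l_μ = 2πm_μ, m_μ is an integer»; `ω` is a function on the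
  unit lattice `T₁^{(k)}` (the multiplier of the constraint `Q′_kλ = 0`).

## What is typed and certified here (kernel-checked, zero sorry)

For the typed `Q′_k = QsOp n M` of `B5Block118` (a matrix `T₁^{(k)} ← T_η`) and the block map
`blockOf` of `B5Blocks16`:
* `QsOp_apply` — the matrix entry: `(Q′_k)_{y,x} = η^d · [x ∈ B^k(y)]`;
* `QsOp_adjoint_mulVec` — the conjugate-transpose `(Q′_k)ᴴ ω` is the block-constant extension
  `x ↦ η^d ω(y(x))`;
* `dft_QsOp_adjoint` — ITS MOMENTUM REPRESENTATION IS THE PRINTED TERM OF (1.30):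
  `((Q′_k)ᴴ ω)^(p′ + l) = c · \overline{u_k(p′+l)} · ω̂(p′)` with `u_k = uSym` of `B5Prop11Fiber`
  and the same constant `c = cQ n M = (√(n^d))⁻¹` as in `dft_QsOp` (so that, in B5's
  normalisations where `c = 1`, `Q′*_k` has symbol `\overline{u_k(p)}` exactly as `Q′_k` has
  symbol `u_k(p)` — (1.30), second equation, `B5Block118.dft_QsOp`);
* tools: `dft_blockConst` (the fine transform of a block-constant function), `cT_fine`
  (`|T_η|^{-1/2} = c·|T₁|^{-1/2}`).

## What is NOT certified here

That B5's `Q′*` (adjoint for the `η^d`-weighted pairing on `T_η` against the unit-lattice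
pairing) is `η^{-d}·(Q′_k)ᴴ` is a statement about pairings we do not type (it only moves the
factor `η^d`); the first equation of (1.30) itself (the variational equation); the vector
analogue `Q*_k`.  Fields complex (B5 real).
-/

open scoped BigOperators Matrix ComplexConjugate
open Finset Complex

namespace Literature.MathematicalPhysics.QuantumFieldTheory.Balaban1983to89.B5Adjoint130

open Literature.MathematicalPhysics.QuantumFieldTheory.Balaban1983to89.B5Prop11Fiber
open Literature.MathematicalPhysics.QuantumFieldTheory.Balaban1983to89.B5Prop11Plancherel
open Literature.MathematicalPhysics.QuantumFieldTheory.Balaban1983to89.B5Block118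
open Literature.MathematicalPhysics.QuantumFieldTheory.Balaban1983to89.B5Blocks16

noncomputable section

variable {d : ℕ} (n : ℕ) [NeZero n] (M : Fin d → ℕ) [hM : ∀ μ, NeZero (M μ)]

/-- the matrix entry of `Q′_k`: `(Q′_k)_{y,x} = η^d` if `x ∈ B^k(y)`, else `0`.
[cite: Balaban1984PropagatorsI, (1.20) p.20] -/
theorem QsOp_apply (y : Tor M) (x : Tor (fine n M)) :
    QsOp n M y x = if B5Blocks16.blockOf n M x = y then 1 / (n : ℂ) ^ d else 0 := by
  obtain ⟨⟨y₀, j₀⟩, rfl⟩ := (bpt_bijective n M).2 x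
  simp only [B5Blocks16.blockOf_bpt]
  unfold QsOp
  by_cases h : y₀ = y
  · subst h
    rw [if_pos rfl, Finset.sum_eq_single j₀]
    · rw [if_pos rfl]
    · intro j _ hj
      rw [if_neg]
      intro hb
      have hinj := bpt_injective n M (a₁ := (y₀, j₀)) (a₂ := (y₀, j)) hb
      exact hj (Prod.ext_iff.mp hinj).2.symm
    · intro h0
      exact absurd (Finset.mem_univ j₀) h0
  · rw [if_neg h]
    refine Finset.sum_eq_zero fun j _ => ?_
    rw [if_neg]
    intro hb
    have hinj := bpt_injective n M (a₁ := (y₀, j₀)) (a₂ := (y, j)) hb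
    exact h (Prod.ext_iff.mp hinj).1

/-- `(Q′_k)ᴴ ω (x) = η^d ω(y(x))`: the conjugate transpose of `Q′_k` extends a unit-lattice function
as a block-constant function (times `η^d`). [cite: Balaban1984PropagatorsI, (1.20) p.20] -/
theorem QsOp_adjoint_mulVec (ω : Tor M → ℂ) (x : Tor (fine n M)) :
    ((QsOp n M)ᴴ *ᵥ ω) x = 1 / (n : ℂ) ^ d * ω (B5Blocks16.blockOf n M x) := by
  have hc : star (1 / (n : ℂ) ^ d) = 1 / (n : ℂ) ^ d := by
    rw [Complex.star_def, map_div₀, map_one, map_pow, Complex.conj_natCast]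
  rw [Matrix.mulVec, dotProduct, Finset.sum_eq_single (B5Blocks16.blockOf n M x)]
  · rw [Matrix.conjTranspose_apply, QsOp_apply, if_pos rfl, hc]
  · intro y _ hy
    rw [Matrix.conjTranspose_apply, QsOp_apply, if_neg (fun h => hy h.symm), star_zero, zero_mul]
  · intro h0
    exact absurd (Finset.mem_univ _) h0

/-- `|T_η|^{-1/2} = c · |T₁|^{-1/2}` (`c = cQ = |T₁|^{1/2}|T_η|^{-1/2}`). [folklore] -/
theorem cT_fine : cT (fine n M) = cQ n M * cT M := by
  have ha : (0 : ℝ) < Fintype.card (Tor M) := by exact_mod_cast Fintype.card_pos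
  have h2 : Real.sqrt (Fintype.card (Tor M) : ℝ) * Real.sqrt (Fintype.card (Tor M) : ℝ)
      = Fintype.card (Tor M) := Real.mul_self_sqrt ha.le
  unfold cQ cT
  calc (Real.sqrt (Fintype.card (Tor (fine n M)) : ℝ))⁻¹
      = (Real.sqrt (Fintype.card (Tor (fine n M)) : ℝ))⁻¹ *
          ((Real.sqrt (Fintype.card (Tor M) : ℝ) * Real.sqrt (Fintype.card (Tor M) : ℝ))⁻¹ *
            (Fintype.card (Tor M) : ℝ)) := by
        rw [h2, inv_mul_cancel₀ ha.ne', mul_one]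
    _ = (Real.sqrt (Fintype.card (Tor M) : ℝ))⁻¹ * (Real.sqrt (Fintype.card (Tor (fine n M)) : ℝ))⁻¹
          * (Fintype.card (Tor M) : ℝ) * (Real.sqrt (Fintype.card (Tor M) : ℝ))⁻¹ := by
        rw [mul_inv]
        ring

/-- the fine Fourier transform of a block-constant function at `p′ + l`:
`Σ_x F_{p′+l,x} ω(y(x)) = c·n^d·\overline{u(p′+l)}·ω̂(p′)` (block decomposition `sum_blocks`,
`e^{-i(p′+l)·ny} = e^{-ip′·y}`, and `Σ_j e^{-i(p′+l)·ηj} = n^d \overline{u}`). [folklore] -/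
theorem dft_blockConst (ω : Tor M → ℂ) (k : Fin d → Fin n) (q : Tor M) :
    (dft (fine n M) *ᵥ fun x => ω (B5Blocks16.blockOf n M x)) (pOf n M (k, q))
      = (cQ n M : ℂ) * (n : ℂ) ^ d * conj (uSym n k (sOf M q)) * (dft M *ᵥ ω) q := by
  have hsum : (dft (fine n M) *ᵥ fun x => ω (B5Blocks16.blockOf n M x)) (pOf n M (k, q))
      = ∑ y : Tor M, ∑ j : Fin d → Fin n,
          dft (fine n M) (pOf n M (k, q)) (bpt n M y j) * ω y := by
    simp only [Matrix.mulVec, dotProduct]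
    rw [sum_blocks n M]
    simp only [B5Blocks16.blockOf_bpt]
  have hentry : ∀ (y : Tor M) (j : Fin d → Fin n),
      dft (fine n M) (pOf n M (k, q)) (bpt n M y j)
        = (cT (fine n M) : ℂ) * conj (chi M q y) * conj (chi (fine n M) (pOf n M (k, q)) (iota n M j)) := by
    intro y j
    rw [dft_apply', bpt, chi_add_right, chi_pOf_up, map_mul, mul_assoc]
  have hM' : (dft M *ᵥ ω) q = ∑ y, (cT M : ℂ) * conj (chi M q y) * ω y := by
    simp only [Matrix.mulVec, dotProduct, dft_apply']
  rw [hsum]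
  simp_rw [hentry]
  calc ∑ y : Tor M, ∑ j : Fin d → Fin n,
        (cT (fine n M) : ℂ) * conj (chi M q y) * conj (chi (fine n M) (pOf n M (k, q)) (iota n M j)) * ω y
      = ∑ y : Tor M, (cT (fine n M) : ℂ) * conj (chi M q y) * ω y *
          conj (∑ j : Fin d → Fin n, chi (fine n M) (pOf n M (k, q)) (iota n M j)) := by
        refine Finset.sum_congr rfl fun y _ => ?_
        rw [map_sum, Finset.mul_sum]
        refine Finset.sum_congr rfl fun j _ => ?_
        ring
    _ = ∑ y : Tor M, (cT (fine n M) : ℂ) * conj (chi M q y) * ω y *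
          ((n : ℂ) ^ d * conj (uSym n k (sOf M q))) := by
        refine Finset.sum_congr rfl fun y _ => ?_
        rw [sum_chi_iota, map_mul, map_pow, Complex.conj_natCast]
    _ = (cQ n M : ℂ) * (n : ℂ) ^ d * conj (uSym n k (sOf M q)) * (dft M *ᵥ ω) q := by
        rw [hM', Finset.mul_sum, cT_fine]
        refine Finset.sum_congr rfl fun y _ => ?_
        push_cast
        ring

/-- (1.30): THE MOMENTUM REPRESENTATION OF `Q′*_k` — «\overline{u_k(p)} ω̃(p′)»:
`((Q′_k)ᴴ ω)^(p′ + l) = c · \overline{u_k(p′+l)} · ω̂(p′)`, `u_k = uSym`, `c = cQ = (√(n^d))⁻¹`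
(the same constant as for `Q′_k` in `B5Block118.dft_QsOp`).
[cite: Balaban1984PropagatorsI, (1.30) p.23] -/
theorem dft_QsOp_adjoint (ω : Tor M → ℂ) (k : Fin d → Fin n) (q : Tor M) :
    (dft (fine n M) *ᵥ ((QsOp n M)ᴴ *ᵥ ω)) (pOf n M (k, q))
      = (cQ n M : ℂ) * conj (uSym n k (sOf M q)) * (dft M *ᵥ ω) q := by
  have hnc : (n : ℂ) ≠ 0 := by exact_mod_cast NeZero.ne n
  have hQ : (QsOp n M)ᴴ *ᵥ ω = fun x => 1 / (n : ℂ) ^ d * ω (B5Blocks16.blockOf n M x) :=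
    funext (QsOp_adjoint_mulVec n M ω)
  have hlin : (dft (fine n M) *ᵥ fun x => 1 / (n : ℂ) ^ d * ω (B5Blocks16.blockOf n M x))
      = (1 / (n : ℂ) ^ d) • (dft (fine n M) *ᵥ fun x => ω (B5Blocks16.blockOf n M x)) := by
    rw [← Matrix.mulVec_smul]
    rfl
  rw [hQ, hlin, Pi.smul_apply, smul_eq_mul, dft_blockConst]
  field_simp

end

end Literature.MathematicalPhysics.QuantumFieldTheory.Balaban1983to89.B5Adjoint130
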